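import Summits.Ventures.HSemireg.WalshParityGeneral

/-!
# Venture HSemireg — t-20's TWO-LETTER LEMMA (family B, g = 8, §2.4 (b)) for every n, part 1: factorisation of the characters on a
# product of two-letter alphabets {ζ_k, ζ_k·i^{d_k}}, the even-step case («flipping one sign»: W-DEAD), and the Walsh analysis on
# (ℤ∕2)ⁿ («a multilinear function supported on an antipodal pair»: parity constancy)

HONEST FRAMING. Part of the Lean index of the computation cell `pub-hsemireg` (Sunday typer seat p9, § g = 8; family B rows **B20-k** of
`target-g8/CENSUS.md` v1.274 `7744dc4867915f69`, in particular the ENGINE-DOOR ROW **B20-8** «configurations Φ⁻¹(coordinate arrangement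
in E⁸) for ONE isogeny Φ : A₀ → E⁸ = designs with ≤ 2 unit letters per factor + pt/E² fillers | A₀, n ≥ 3 | — | never EXACT ∧ W-ALIVE
(LEMMA §2.4(b)); n = 2: exactly Z₂»). FINITE GAUSSIAN-INTEGER ARITHMETIC ONLY, continuing `WalshParityGeneral.lean` (vocabulary
`Letter n`, `Sgn n`, `I`, `sgnExp`, `chi`, `wsign`, `wt`, `moment`). No abelian variety, isogeny, graph Γ_D, cycle, class or filler is
constructed; LEMMA W («class-completable ⟺ all mixed full moments vanish; W-alive ⟺ m̂(1,…,1) ≠ 0») and the identification «Φ⁻¹(coordinate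
arrangement) = two letters per factor» are the DICTIONARY — TEXT OF RECORD, not binders and not proved here; nothing here says that HC ∕
HC_CM ∕ HC_AV holds; no object is certified; no Literature fact is declared.

TEXT OF RECORD (quoted, not interpreted). Source: t-20, `target-g8/FAMILY-B-G8-t20.md` v1.25 `987a3ee140325c40`, §2.4 (b): «TWO LETTERS
PER FACTOR: if every factor uses only two unit letters {ζ_k, ζ_k i^{d_k}} then (flipping one sign of ε shows) every d_k is odd, the 16
full moments become a multilinear function on {±1}⁴ that must be supported on an antipodal pair, and positivity of m forces m ≡ 0 for
n ≥ 3 (at n = 2 it gives exactly Z₂ = {(1,1),(i,−i)}). So no W-alive exact effective design lives in a product of 2-letter alphabets for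
n ≥ 3 — the configurations reachable as Φ⁻¹(coordinate arrangement) for ONE isogeny Φ = (w_k − ζ_k z_k, w_k − ζ′_k z_k)_k : A₀ → E⁸ are
of this form (coordinate 4-planes pull back to Γ_D with D_k ∈ {ζ_k, ζ′_k}, or to pt/E²-factor fillers).»

WHAT THIS FILE PROVES (exponent vectors: the alphabet of factor k is {a_k, a_k + d_k} ⊂ ℤ∕4, d_k ≠ 0; a design `m : (ℤ∕4)ⁿ → ℤ` is
«two-letter» when m(x) ≠ 0 ⇒ x_k ∈ {a_k, a_k + d_k} for every k — carried as an explicit hypothesis, no named predicate). §1 `pt a d y` (the letter vector a + y·d of a parameter y ∈ (ℤ∕2)ⁿ),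
`cy d y` = Π_{y_k = 1} i^{d_k}, the per-factor identity `factor_identity` (d odd: i^{ε(a + b·d)} = i^{εa}·(ε·i^{d})^b, kernel `decide`
over the 64 cases) and the FACTORISATION **`chi_pt`**: i^{ε(δ)·(a + y·d)} = i^{ε(δ)·a}·(−1)^{δ·y}·c(y) when every d_k is odd. §2 the
EVEN-STEP CASE **`moment_zero_eq_zero_of_even_step`** («flipping one sign of ε»): if n ≥ 2 and the alphabet of some factor k₀ is
{a, a + 2}, then mixed moments 0 ⇒ m̂(+,…,+) = 0 (W-dead) — for every integer m, no positivity needed. §3 WALSH ANALYSIS on (ℤ∕2)ⁿ: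
`qfun` = q(y) = m(a + y·d)·c(y), `qhat` = its Walsh transform, `moment_eq_chi_mul_qhat` (m̂(δ) = i^{ε(δ)·a}·q̂(δ) for two-letter m),
`walsh_inversion_sgn` (2ⁿ·q(y) = Σ_δ (−1)^{δ·y} q̂(δ)), **`qfun_eq_of_parity`** (mixed moments 0 ⇒ q(y) depends only on |y| mod 2 — «a
multilinear function on {±1}ⁿ supported on an antipodal pair»). The POSITIVITY step (n ≥ 3, all d_k odd ⇒ m ≡ 0) and the door
statement of row B20-8 («never EXACT ∧ W-ALIVE» for n ≥ 3, any steps) are the sequel `WalshParityTwoLetterDoor.lean`.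

WHAT IS NOT HERE. The positivity endgame (sequel); the n = 2 clause «exactly Z₂»; LEMMA W and the isogeny dictionary; fillers; any
sheaf or class computation.
-/

namespace Summit.Ventures.HSemireg.WalshParityN

open Finset

variable {n : ℕ}

/-! ## §1 Two-letter alphabets and the factorisation of the characters -/

/-- Powers of `i` are non-zero. -/
theorem I_pow_ne_zero (v : ℕ) : I ^ v ≠ 0 := pow_ne_zero v (by decide)

/-- The character as a product over the factors: `i^{ε·x} = Π_k i^{ε_k x_k}`. -/
theorem chi_eq_prod (δ : Sgn n) (x : Letter n) : chi δ x = ∏ k, I ^ (sgnExp (δ k) (x k)) := by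
  rw [chi, Finset.prod_pow_eq_pow_sum]

/-- Characters never vanish. -/
theorem chi_ne_zero (δ : Sgn n) (x : Letter n) : chi δ x ≠ 0 := I_pow_ne_zero _

/-- The letter vector `a + y·d` of the parameter `y ∈ (ℤ∕2)ⁿ` in the product alphabet `Π_k {a_k, a_k + d_k}`. [definition of this file] -/
def pt (a : Letter n) (d : Fin n → Fin 4) (y : Sgn n) : Letter n := fun k => a k + (if y k = 1 then d k else 0)

/-- The unit `c(y) = Π_{k : y_k = 1} i^{d_k}`. [definition of this file] -/
def cy (d : Fin n → Fin 4) (y : Sgn n) : GaussianInt := ∏ k, (if y k = 1 then I ^ (d k).val else 1)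

/-- `c(y) ≠ 0`. -/
theorem cy_ne_zero (d : Fin n → Fin 4) (y : Sgn n) : cy d y ≠ 0 := by
  refine Finset.prod_ne_zero_iff.mpr (fun k _ => ?_)
  split_ifs
  · exact I_pow_ne_zero _
  · exact one_ne_zero

/-- PER-FACTOR IDENTITY (odd step): `i^{ε(a + b·d)} = i^{εa}·(ε·i^{d})^b` for `ε = (−1)^e`, `b ∈ {0,1}`, `d` odd — all 64 cases by
kernel `decide` (conjugation flips `i^d = ±i`). -/
theorem factor_identity : ∀ (e : Fin 2) (u v : Fin 4) (b : Fin 2), v.val % 2 = 1 →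
    I ^ (sgnExp e (u + if b = 1 then v else 0)) = I ^ (sgnExp e u) * (if b = 1 then (-1) ^ e.val * I ^ v.val else 1) := by
  decide

/-- **FACTORISATION ON A TWO-LETTER ALPHABET (all steps odd):** `i^{ε(δ)·(a + y·d)} = i^{ε(δ)·a}·(−1)^{δ·y}·c(y)`. -/
theorem chi_pt (a : Letter n) (d : Fin n → Fin 4) (hodd : ∀ k, (d k).val % 2 = 1) (δ y : Sgn n) :
    chi δ (pt a d y) = chi δ a * ((wsign δ y : GaussianInt) * cy d y) := by
  rw [chi_eq_prod, chi_eq_prod, wsign_eq, ← Finset.prod_pow_eq_pow_sum, cy, ← Finset.prod_mul_distrib,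
    ← Finset.prod_mul_distrib]
  refine Finset.prod_congr rfl (fun k _ => ?_)
  simp only [pt]
  rw [factor_identity (δ k) (a k) (d k) (y k) (hodd k)]
  congr 1
  by_cases h : y k = 1
  · rw [if_pos h, if_pos h, h, Fin.val_one, mul_one]
  · have h0 : y k = 0 := by
      have hfin : ∀ b : Fin 2, b ≠ 1 → b = 0 := by decide
      exact hfin _ h
    rw [if_neg h, if_neg h, h0, Fin.val_zero, mul_zero, pow_zero, one_mul]

/-- `y ↦ a + y·d` is injective when no step vanishes. -/
theorem pt_injective (a : Letter n) (d : Fin n → Fin 4) (hd : ∀ k, d k ≠ 0) : Function.Injective (pt a d) := by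
  intro y y' h
  funext k
  have hk := congrFun h k
  simp only [pt] at hk
  have hk' := add_left_cancel hk
  by_cases h1 : y k = 1 <;> by_cases h2 : y' k = 1
  · rw [h1, h2]
  · rw [if_pos h1, if_neg h2] at hk'; exact absurd hk' (hd k)
  · rw [if_neg h1, if_pos h2] at hk'; exact absurd hk'.symm (hd k)
  · have hfin : ∀ b : Fin 2, b ≠ 1 → b = 0 := by decide
    rw [hfin _ h1, hfin _ h2]

/-- A support letter of a two-letter design is `a + y·d` for some parameter `y`. -/
theorem exists_pt_of_twoLetter {a : Letter n} {d : Fin n → Fin 4} {m : Letter n → ℤ}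
    (h : ∀ x : Letter n, m x ≠ 0 → ∀ k, x k = a k ∨ x k = a k + d k)
    (x : Letter n) (hx : m x ≠ 0) : ∃ y : Sgn n, pt a d y = x := by
  refine ⟨fun k => if x k = a k then 0 else 1, ?_⟩
  funext k
  by_cases hxa : x k = a k
  · simp [pt, hxa]
  · have hk : x k = a k + d k := (h x hx k).resolve_left hxa
    simpa [pt, hxa] using hk.symm

/-- Moments of a two-letter design as sums over the parameter space (ℤ∕2)ⁿ. -/
theorem moment_eq_sum_pt (a : Letter n) (d : Fin n → Fin 4) (hd : ∀ k, d k ≠ 0) (m : Letter n → ℤ)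
    (h : ∀ x : Letter n, m x ≠ 0 → ∀ k, x k = a k ∨ x k = a k + d k) (δ : Sgn n) :
    moment m δ = ∑ y : Sgn n, (m (pt a d y) : GaussianInt) * chi δ (pt a d y) := by
  unfold moment
  symm
  rw [← Finset.sum_image (s := Finset.univ) (g := pt a d) (f := fun x => (m x : GaussianInt) * chi δ x)
    (fun y _ y' _ hyy => pt_injective a d hd hyy)]
  apply Finset.sum_subset (Finset.subset_univ _)
  intro x _ hx
  have hmx : m x = 0 := by
    by_contra hmx
    obtain ⟨y, hy⟩ := exists_pt_of_twoLetter h x hmx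
    exact hx (Finset.mem_image.mpr ⟨y, Finset.mem_univ _, hy⟩)
  simp [hmx]

/-! ## §2 The even-step case («flipping one sign of ε shows every d_k is odd») -/

/-- **EVEN STEP ⇒ W-DEAD:** if `n ≥ 2` and every support letter has `x_{k₀} ∈ {a, a + 2}` at some factor `k₀`, then vanishing of the
mixed moments forces `m̂(+,…,+) = 0` — flip the sign `ε_{k₀}`: the character changes by the constant factor `(−1)^{x_{k₀}} = (−1)^a` on
the support, so `m̂(flip) = (−1)^a·m̂(+,…,+)`, and the flipped pattern is mixed. Holds for every integer design (no positivity). -/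
theorem moment_zero_eq_zero_of_even_step (hn : 2 ≤ n) (m : Letter n → ℤ) (k₀ : Fin n) (a₀ : Fin 4)
    (hsupp : ∀ x : Letter n, m x ≠ 0 → x k₀ = a₀ ∨ x k₀ = a₀ + 2)
    (hmixed : ∀ δ : Sgn n, δ ≠ 0 → δ ≠ 1 → moment m δ = 0) : moment m 0 = 0 := by
  set δ' : Sgn n := Pi.single k₀ 1 with hδ'
  have hδ'0 : δ' ≠ 0 := by
    intro h
    have := congrFun h k₀
    rw [hδ', Pi.single_eq_same, Pi.zero_apply] at this
    exact absurd this (by decide)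
  -- a second index shows δ' is not the all-minus pattern
  obtain ⟨j, hj⟩ : ∃ j : Fin n, j ≠ k₀ := by
    by_cases hk : k₀.val = 0
    · exact ⟨⟨1, by omega⟩, fun h => by have := congrArg Fin.val h; simp at this; omega⟩
    · exact ⟨⟨0, by omega⟩, fun h => by have := congrArg Fin.val h; simp at this; omega⟩
  have hδ'1 : δ' ≠ 1 := by
    intro h
    have := congrFun h j
    rw [hδ', Pi.single_eq_of_ne hj, Pi.one_apply] at this
    exact absurd this (by decide)
  -- the flipped character: chi δ' x = i^{|x|}·(−1)^{x_{k₀}}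
  have hchi : ∀ x : Letter n, chi δ' x = I ^ (wt x) * (-1) ^ (x k₀).val := by
    intro x
    rw [chi_eq]
    congr 2
    rw [Finset.sum_eq_single k₀]
    · rw [hδ', Pi.single_eq_same, Fin.val_one, one_mul]
    · intro k _ hk
      rw [hδ', Pi.single_eq_of_ne hk, Fin.val_zero, zero_mul]
    · intro h; exact absurd (Finset.mem_univ _) h
  -- on the support (−1)^{x_{k₀}} = (−1)^{a₀}
  have hsign : ∀ x : Letter n, m x ≠ 0 → ((-1) ^ (x k₀).val : GaussianInt) = (-1) ^ a₀.val := by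
    intro x hx
    rw [neg_one_pow_eq_pow_mod_two, neg_one_pow_eq_pow_mod_two (n := a₀.val)]
    congr 1
    rcases hsupp x hx with h | h
    · rw [h]
    · rw [h, Fin.val_add]
      have : (2 : Fin 4).val = 2 := rfl
      rw [this]
      omega
  have hflip : moment m δ' = (-1) ^ a₀.val * moment m 0 := by
    simp only [moment, Finset.mul_sum]
    refine Finset.sum_congr rfl (fun x _ => ?_)
    by_cases hx : m x = 0
    · simp [hx]
    · rw [hchi x, hsign x hx, chi_zero]
      ring
  have h0 := hmixed δ' hδ'0 hδ'1
  rw [hflip] at h0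
  rcases mul_eq_zero.mp h0 with h | h
  · exact absurd h (pow_ne_zero _ (neg_ne_zero.mpr one_ne_zero))
  · exact h

/-! ## §3 Walsh analysis of a two-letter design on (ℤ∕2)ⁿ (all steps odd) -/

/-- `q(y) = m(a + y·d)·c(y)`. [definition of this file] -/
def qfun (a : Letter n) (d : Fin n → Fin 4) (m : Letter n → ℤ) (y : Sgn n) : GaussianInt :=
  (m (pt a d y) : GaussianInt) * cy d y

/-- The Walsh transform `q̂(δ) = Σ_y (−1)^{δ·y} q(y)`. [definition of this file] -/
def qhat (a : Letter n) (d : Fin n → Fin 4) (m : Letter n → ℤ) (δ : Sgn n) : GaussianInt :=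
  ∑ y : Sgn n, (wsign δ y : GaussianInt) * qfun a d m y

/-- Odd steps do not vanish. -/
theorem ne_zero_of_odd {d : Fin n → Fin 4} (hodd : ∀ k, (d k).val % 2 = 1) (k : Fin n) : d k ≠ 0 := by
  intro h
  have := hodd k
  rw [h, Fin.val_zero] at this
  omega

/-- `m̂(δ) = i^{ε(δ)·a}·q̂(δ)` for a two-letter design with odd steps. -/
theorem moment_eq_chi_mul_qhat (a : Letter n) (d : Fin n → Fin 4) (hodd : ∀ k, (d k).val % 2 = 1) (m : Letter n → ℤ)
    (h : ∀ x : Letter n, m x ≠ 0 → ∀ k, x k = a k ∨ x k = a k + d k) (δ : Sgn n) : moment m δ = chi δ a * qhat a d m δ := by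
  rw [moment_eq_sum_pt a d (ne_zero_of_odd hodd) m h δ, qhat, Finset.mul_sum]
  refine Finset.sum_congr rfl (fun y _ => ?_)
  rw [chi_pt a d hodd δ y, qfun]
  ring

/-- `Σ_δ (−1)^{δ·y}(−1)^{δ·y'} = 2ⁿ·[y = y']`. -/
theorem sum_wsign_mul_wsign (y y' : Sgn n) :
    (∑ δ : Sgn n, (wsign δ y : GaussianInt) * (wsign δ y' : GaussianInt)) = if y = y' then 2 ^ n else 0 := by
  have h : ∀ δ : Sgn n, (wsign δ y : GaussianInt) * (wsign δ y' : GaussianInt)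
      = (-1 : GaussianInt) ^ (∑ k, (δ k).val * ((y k).val + (y' k).val)) := by
    intro δ
    have hsum : (∑ k, (δ k).val * ((y k).val + (y' k).val))
        = (∑ k, (δ k).val * (y k).val) + ∑ k, (δ k).val * (y' k).val := by
      rw [← Finset.sum_add_distrib]
      exact Finset.sum_congr rfl (fun k _ => by ring)
    rw [wsign_eq, wsign_eq, hsum, pow_add]
  rw [Finset.sum_congr rfl (fun δ _ => h δ), walsh_sum (fun k => (y k).val + (y' k).val)]
  have hiff : (∀ k, ((y k).val + (y' k).val) % 2 = 0) ↔ y = y' := by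
    constructor
    · intro hall
      funext k
      apply Fin.ext
      have := hall k
      have := (y k).isLt
      have := (y' k).isLt
      omega
    · rintro rfl k
      omega
  by_cases hy : y = y'
  · rw [if_pos (hiff.mpr hy), if_pos hy]
  · rw [if_neg (fun hall => hy (hiff.mp hall)), if_neg hy]

/-- WALSH INVERSION ON (ℤ∕2)ⁿ: `2ⁿ·q(y) = Σ_δ (−1)^{δ·y} q̂(δ)`. -/
theorem walsh_inversion_sgn (a : Letter n) (d : Fin n → Fin 4) (m : Letter n → ℤ) (y : Sgn n) :
    (2 : GaussianInt) ^ n * qfun a d m y = ∑ δ : Sgn n, (wsign δ y : GaussianInt) * qhat a d m δ := by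
  symm
  calc (∑ δ : Sgn n, (wsign δ y : GaussianInt) * qhat a d m δ)
      = ∑ δ : Sgn n, ∑ y' : Sgn n, (wsign δ y : GaussianInt) * (wsign δ y' : GaussianInt) * qfun a d m y' := by
        refine Finset.sum_congr rfl (fun δ _ => ?_)
        rw [qhat, Finset.mul_sum]
        exact Finset.sum_congr rfl (fun y' _ => by ring)
    _ = ∑ y' : Sgn n, (∑ δ : Sgn n, (wsign δ y : GaussianInt) * (wsign δ y' : GaussianInt)) * qfun a d m y' := by
        rw [Finset.sum_comm]
        exact Finset.sum_congr rfl (fun y' _ => by rw [Finset.sum_mul])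
    _ = ∑ y' : Sgn n, (if y = y' then 2 ^ n else 0) * qfun a d m y' := by
        exact Finset.sum_congr rfl (fun y' _ => by rw [sum_wsign_mul_wsign])
    _ = (2 : GaussianInt) ^ n * qfun a d m y := by
        simp_rw [ite_mul, zero_mul]
        rw [Finset.sum_ite_eq, if_pos (Finset.mem_univ _)]

/-- **PARITY CONSTANCY («supported on an antipodal pair»):** for a two-letter design with odd steps and vanishing mixed moments
(n ≥ 1), `q(y)` depends only on the parity of `|y|`. -/
theorem qfun_eq_of_parity (hn : 0 < n) (a : Letter n) (d : Fin n → Fin 4) (hodd : ∀ k, (d k).val % 2 = 1) (m : Letter n → ℤ)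
    (h : ∀ x : Letter n, m x ≠ 0 → ∀ k, x k = a k ∨ x k = a k + d k) (hmixed : ∀ δ : Sgn n, δ ≠ 0 → δ ≠ 1 → moment m δ = 0) (y y' : Sgn n)
    (hpar : (∑ k, (y k).val) % 2 = (∑ k, (y' k).val) % 2) : qfun a d m y = qfun a d m y' := by
  have hq : ∀ δ : Sgn n, δ ≠ 0 → δ ≠ 1 → qhat a d m δ = 0 := by
    intro δ h0 h1
    have hm := hmixed δ h0 h1
    rw [moment_eq_chi_mul_qhat a d hodd m h δ] at hm
    rcases mul_eq_zero.mp hm with hc | hc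
    · exact absurd hc (chi_ne_zero δ a)
    · exact hc
  have hinv : ∀ z : Sgn n, (2 : GaussianInt) ^ n * qfun a d m z
      = qhat a d m 0 + (wsign 1 z : GaussianInt) * qhat a d m 1 := by
    intro z
    rw [walsh_inversion_sgn]
    rw [Finset.sum_eq_add_of_mem (0 : Sgn n) (1 : Sgn n) (Finset.mem_univ _) (Finset.mem_univ _) (zero_ne_one_sgn hn)]
    · rw [wsign_zero]; simp
    · intro δ _ hδ
      rw [hq δ hδ.1 hδ.2, mul_zero]
  have hw : wsign 1 y = wsign 1 y' := by rw [wsign_one, wsign_one, hpar]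
  have h2 : (2 : GaussianInt) ^ n * qfun a d m y = (2 : GaussianInt) ^ n * qfun a d m y' := by
    rw [hinv y, hinv y', hw]
  exact mul_left_cancel₀ (pow_ne_zero n two_ne_zero) h2

end Summit.Ventures.HSemireg.WalshParityN
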